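import Literature.NumberTheory.LFunctions.SuzukiWeilHilbertSpace
import Literature.NumberTheory.LFunctions.SuzukiScrewLineL2Proofs
import HarnessLib

/-!
# CJM Cor. 1.5 bookkeeping with Prop. 1.3 discharged (hypothesis-free forms)

LINE 1 — LABEL: RH-FREE corpus theorems (M. Suzuki, *On the Hilbert space derived from the Weil
distribution*, Canad. J. Math. 2025 = arXiv:2301.00421v3, Cor. 1.5 with Prop. 1.3 and Thm. 1.4).
bears_on: B-C/B-P (COLUMN 6 DBR). WHAT THIS IS NOT: Cor. 1.5 / Thm. 1.4 themselves are
RH-EQUIVALENT·PRINTED criteria and are NOT asserted; the theorems below remove a since-proved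
hypothesis from the cell's glue; nothing here bears on the truth of RH.

The module `SuzukiWeilHilbertSpace.lean` (§F) proved the Cor. 1.5 bookkeeping — every test function
generates an element of `V°(0)`, "(1.9) is reformulated to (1.10)", Cor. 1.5 ⟺ Thm. 1.4, and the
RH-free half "(1.10) on `V°(0)` ⟹ RH" — modulo the RH-free named fact `Suzuki2025_prop13`
(`P̂_φ ∈ L²(ℝ)` for `φ ∈ C_c^∞(ℝ)`, CJM Prop. 1.3). That fact is now a tree theorem
(`Suzuki2025_prop13_holds`, `SuzukiScrewLineL2Proofs.lean`, cell row t7), so the four statements hold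
outright. Proof-only file (no definitions, no named facts); kept separate from
`SuzukiWeilHilbertSpace.lean` so that module's dependency cone stays free of the screw-line
`L²` estimates.

## References
* M. Suzuki, Canad. J. Math. 2025 (doi:10.4153/S0008414X25101739) = arXiv:2301.00421v3, Cor. 1.5
  p. 3 (TeX l.438–451), Prop. 1.3 (TeX l.392–405), proof of Cor. 1.5 §4.3 p. 12 (TeX l.1352–1380).
  [Suzuki2025WeilHilbertSpace]
-/

noncomputable section

open MeasureTheory Complex
open scoped ComplexConjugate FourierTransform

namespace Literature.NumberTheory.LFunctions

/-- **Every test function generates an element of `V°(0)`**, unconditionally: for `ψ₀ ∈ C_c^∞(ℝ)`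
the class `ψ = 𝖥⁻¹P̂_{Dψ₀} ∈ V°(0)` exists (`exists_mem_suzukiVcirc` with CJM Prop. 1.3 discharged
by `Suzuki2025_prop13_holds`). RH-FREE.
[cite: Suzuki2025WeilHilbertSpace, CJM Cor. 1.5 p. 3 (TeX l.438–444) with Prop. 1.3 (TeX l.392–405)] -/
theorem IsWeilTest.exists_mem_suzukiVcirc {ψ₀ : ℝ → ℂ} (hψ₀ : IsWeilTest ψ₀) :
    ∃ ψ ∈ suzukiVcirc, IsVcircRep ψ₀ ψ :=
  Literature.NumberTheory.LFunctions.exists_mem_suzukiVcirc Suzuki2025_prop13_holds hψ₀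

/-- `V°(0)` has a generated element for every test function; in particular it is not reduced to the
classes generated by `ψ₀ = 0` unless every `P̂_{Dψ₀}` vanishes — recorded as the plain existence
statement `∀ ψ₀ ∈ C_c^∞, ∃ ψ ∈ V°(0), 𝖥ψ = P̂_{Dψ₀}`. RH-FREE.
[cite: Suzuki2025WeilHilbertSpace, CJM Cor. 1.5 p. 3 (TeX l.438–444: "V°(0) := {𝖥⁻¹P̂_{Dψ} | ψ ∈ C_c^∞(ℝ)}")] -/
theorem forall_isWeilTest_exists_mem_suzukiVcirc :
    ∀ ψ₀ : ℝ → ℂ, IsWeilTest ψ₀ → ∃ ψ ∈ suzukiVcirc, IsVcircRep ψ₀ ψ :=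
  fun _ hψ₀ ↦ hψ₀.exists_mem_suzukiVcirc

/-- **"Equation (1.9) is reformulated to (1.10)"**, unconditionally: condition (1.10) on `V°(0)` is
equivalent to condition (1.9) on `C_c^∞(ℝ)` (`Suzuki2025_eq110_iff_eq19` with CJM Prop. 1.3
discharged). RH-FREE; neither condition is asserted.
[cite: Suzuki2025WeilHilbertSpace, CJM p. 3 (TeX l.436) and proof of Cor. 1.5 §4.3 p. 12 (TeX l.1352–1380)] -/
theorem Suzuki2025_eq110_iff_eq19' :
    (∀ ψ ∈ suzukiVcirc, ∀ ψ₀ : ℝ → ℂ, IsWeilTest ψ₀ → IsVcircRep ψ₀ ψ →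
        ((2 * ‖ψ‖ ^ 2 : ℝ) : ℂ) = weilQuadratic ψ₀) ↔
      ∀ ψ₀ : ℝ → ℂ, IsWeilTest ψ₀ →
        ((∫ x : ℝ, ‖screwPhat (suzukiD ψ₀) x‖ ^ 2 : ℝ) : ℂ) = Real.pi * weilQuadratic ψ₀ :=
  Suzuki2025_eq110_iff_eq19 Suzuki2025_prop13_holds

/-- **CJM Cor. 1.5 and CJM Thm. 1.4 are the same statement in the kernel**, unconditionally: the two
RH-EQUIVALENT·PRINTED named facts `Suzuki2025_cor15` and `Suzuki2025_thm14` are interderivable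
(`Suzuki2025_cor15_of`, `Suzuki2025_thm14_of_cor15` with Prop. 1.3 discharged). Neither is asserted;
RH-FREE glue. [cite: Suzuki2025WeilHilbertSpace, CJM Cor. 1.5 p. 3 (TeX l.436: "Equation (1.9) is reformulated to the following simpler form"), proof §4.3 p. 12] -/
theorem Suzuki2025_cor15_iff_thm14 : Suzuki2025_cor15 ↔ Suzuki2025_thm14 :=
  ⟨Suzuki2025_thm14_of_cor15 Suzuki2025_prop13_holds, Suzuki2025_cor15_of Suzuki2025_prop13_holds⟩

/-- **The RH-free half of CJM Cor. 1.5, unconditionally: (1.10) on `V°(0)` implies RH**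
(`Suzuki2025_cor15_if` with CJM Prop. 1.3 discharged; the door is Weil's criterion,
`weil_criterion_holds`, COLUMN 2). RH-FREE; the hypothesis (1.10) is RH-EQUIVALENT and is NOT
asserted anywhere. [cite: Suzuki2025WeilHilbertSpace, CJM proof of Cor. 1.5 §4.3 p. 12 (TeX l.1353–1354) and proof of Thm. 4.4 (TeX l.1303–1337)] -/
theorem Suzuki2025_cor15_if'
    (h : ∀ ψ ∈ suzukiVcirc, ∀ ψ₀ : ℝ → ℂ, IsWeilTest ψ₀ → IsVcircRep ψ₀ ψ →
      ((2 * ‖ψ‖ ^ 2 : ℝ) : ℂ) = weilQuadratic ψ₀) :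
    RiemannHypothesis :=
  Suzuki2025_cor15_if Suzuki2025_prop13_holds h

end Literature.NumberTheory.LFunctions

end
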